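import Literature.RingTheory.KTheory.MilnorKTameSymbol
import Literature.RingTheory.KTheory.MilnorKGroupsFiniteField
import Literature.RingTheory.KTheory.KTwoRatFuncFiltration
import HarnessLib

/-!
# The filtration `L_d ⊂ K_nF(t)` by degree, LEMMA 2.4 (`h_π`) and the generation half of LEMMA 2.5, in all degrees
# (Milnor, *Algebraic K-theory and quadratic forms*, Invent. Math. 9 (1970), §2, proof of Theorem 2.3)

Family `hodge`, lane `lit-hodgefound` (foundations library; seat `lit-hodgefound-p27`, generation 40, row g40-#2);
topic `RingTheory/KTheory`.  Sequel of `MilnorKTameSymbol` (g40-#1: LEMMAS 2.1/2.2, the `cons`-calculus,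
`symbol_eq_symbol_update_neg_one`), of `MilnorKGroupsFiniteField` (g39-#13: functoriality `MilnorK.map`) and of the
`K₂`-version `KTwoRatFuncFiltration` (g39-#5), whose polynomial set-up is reused verbatim: `polyUnitsBelow`,
`atomsBelow`, `closure_polyUnitsBelow_eq_closure_atomsBelow`, `polyUnit_C_neg_one`, `exists_mem_closure_polyUnitsBelow`,
`polyUnit_eq_map_of_natDegree_eq_zero`, `hRep` (+ `RatFuncPrimeTameSymbols`: `monicGen`, `primeDeg`, `primeOf`,
`polyUnit`, `residueClassUnit`).  Here the same argument is carried out in `K_{n+1}F(t) = MilnorK (RatFunc F) (n+1)`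
for ALL `n` (additively), where the new difficulties are purely combinatorial: the polynomials of top degree may
sit at any set of slots (Lemma 1.1 moves them, Lemma 1.2 merges equal ones).  DEFINITIONS WITH BODIES
(`symbolsBelowK`, `filtrationK`, `constMap`, `genUnit`, `repUnit`, `hTuple`, `hFun`, `hFunSlot`, `hMulti`, `hMapK`,
`topSymbolsK`, `topPartK`) and PROVED THEOREMS; no named fact, no instance, no notation, 0 `sorry`, net debt 0 (D-0026).

## The source, verbatim

J. Milnor, *Algebraic K-theory and quadratic forms*, Invent. Math. 9 (1970) 318–344 (held `paper:doi-10-1007-bf01425486`;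
bib key `Milnor1970`), §2 (p0008 L5 – p0010 L12): «Now let F be an arbitrary field. We will use 2.1 and 2.2 to study
the field F(t) of rational functions in one indeterminate over F. Each monic irreducible polynomial π ∈ F[t] gives rise
to a (π)-adic valuation on F(t) with residue class field F[t]/(π). […] **THEOREM 2.3.** These homomorphisms ∂_π give
rise to a split exact sequence 0 → K_nF → K_nF(t) → ⊕ K_{n−1}F[t]/(π) → 0, where the direct sum extends over all
non-zero prime ideals (π). […] *Proof.* Keeping n fixed, let L_d ⊂ K_nF(t) be the subgroup generated by those
products l(f₁)⋯l(fₙ) such that f₁, …, fₙ ∈ F[t] are polynomials of degree ≤ d. Thus L₀ ⊂ L₁ ⊂ L₂ ⊂ … with union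
K_nF(t). Using the homomorphism ψ : K_*F(t) → K_*F of 2.2, where π is any monic (irreducible) polynomial of degree 1,
we see easily that L₀ is a direct summand of K_nF(t), naturally isomorphic to K_nF. Let π be a monic irreducible
polynomial of degree d. Then each element ḡ of the quotient F[t]/(π) is represented by a unique polynomial g ∈ F[t]
of degree < d. **LEMMA 2.4.** There exists one and only one homomorphism h_π : K_{n−1}F[t]/(π) → L_d/L_{d−1} which
carries each product l(ḡ₂)⋯l(ḡₙ) to the residue class of l(π)l(g₂)⋯l(gₙ) modulo L_{d−1}. *Proof.* First consider the
correspondence l(ḡ₂) × ⋯ × l(ḡₙ) ↦ l(π)l(g₂)⋯l(gₙ) mod L_{d−1} from K₁F[t]/(π) × ⋯ × K₁F[t]/(π) to L_d/L_{d−1}. We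
will show that this correspondence is linear, for example as a function of g₂. Suppose that ḡ₂ = ḡ₂′ḡ₂″ mod (π),
where g₂, g₂′, g₂″ are polynomials of degree < d. Then g₂ = πf + g₂′g₂″ where f is also a polynomial of degree < d.
Hence, if f ≠ 0, 1 = πf/g₂ + g₂′g₂″/g₂ and therefore (l(π) + l(f) − l(g₂))(l(g₂′) + l(g₂″) − l(g₂)) = 0. Multiplying on
the right by l(g₃)⋯l(gₙ), and then reducing modulo L_{d−1}, we obtain l(π)(l(g₂′) + l(g₂″) − l(g₂))l(g₃)⋯l(gₙ) = 0.
Since the case f = 0 is straightforward, this proves that our correspondence is (n−1)-linear. To prove that this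
correspondence gives rise to a homomorphism l(ḡ₂)⋯l(ḡₙ) ↦ l(π)l(g₂)⋯l(gₙ) from K_{n−1}F̄ to L_d/L_{d−1}, it is now only
necessary to note that the image is zero whenever ḡⱼ + ḡⱼ₊₁ = 1 and hence gⱼ + gⱼ₊₁ = 1. This proves 2.4.
**LEMMA 2.5.** The homomorphisms ∂_π give rise to an isomorphism between L_d/L_{d−1} and the direct sum of
K_{n−1}F[t]/(π) as π ranges over monic irreducible polynomials of degree d. *Proof.* […] So to complete the argument we
need only to show that L_d/L_{d−1} is generated by the images of the h_π. Consider any generator of L_d, expressed as a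
product l(f₁)⋯l(f_s)l(g_{s+1})⋯l(gₙ) where f₁, …, f_s have degree d and g_{s+1}, …, gₙ have degree < d. If s ≥ 2 then
we can set f₂ = −af₁ + g with a ∈ F• and degree g < d. If g ≠ 0 it follows that af₁/g + f₂/g = 1 hence
(l(a) + l(f₁) − l(g))(l(f₂) − l(g)) = 0. Thus the product l(f₁)l(f₂) can be expressed as a sum of terms
l(f₁)l(g) + l(g)l(f₂) − l(a)l(f₂) + l(a)l(g) − l(g)², each of which involves at most one polynomial of degree d. A
similar situation obtains when g = 0. It follows, by induction on s, that every element of L_d can be expressed,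
modulo L_{d−1}, in terms of products l(f₁)l(g₂)⋯l(gₙ) where only f₁ has degree d. If f₁ is irreducible, then setting
f₁ = aπ this product evidently belongs to the image of h_π. But if f₁ is reducible then the product is congruent to
zero modulo L_{d−1}. Thus L_d/L_{d−1} is generated by the images of the homomorphisms h_π, which completes the proof
of 2.5.»

## What is formalised (symbols of length `n + 1` in `K_{n+1}F(t)`; Milnor's `d` is our `d + 1` where it matters)

* §0 **`symbol_mem_of_forall_mem_closure`**: the multilinearity of `{a₁, …, aₙ}` turns «generated by the products of
  polynomials of degree ≤ d» into membership for arbitrary quotients, slot by slot (the good set at each slot is a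
  subgroup).
* §1 «L_d ⊂ K_nF(t)»: `symbolsBelowK`, **`filtrationK F n d = L_d`** (`filtrationK_mono` «L₀ ⊂ L₁ ⊂ …»,
  `symbol_mem_filtrationK(_of_mem_closure)`, `iSup_filtrationK_eq_top` / `exists_mem_filtrationK` «with union K_nF(t)»),
  the first map `constMap F n : K_nF →+ K_nF(t)` of Theorem 2.3 and **`filtrationK_zero_le_range_constMap`**
  («L₀ … naturally isomorphic to K_nF»).
* §2 **LEMMA 2.4**: the linearity at an ARBITRARY slot `symbol_cons_monicGen_linear_mem` («g₂ = πf + g₂′g₂″ … 1 = πf/g₂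
  + g₂′g₂″/g₂», with the Steinberg relation at the non-adjacent slots `0, j+1` of `MilnorKGroups`), the representatives
  `repUnit`/`hTuple`, the correspondence `hFun` and its multilinearity (`hFun_update_add`, `hFun_update_zsmul`,
  `hMulti`), «ḡⱼ + ḡⱼ₊₁ = 1 hence gⱼ + gⱼ₊₁ = 1» (`hRep_add_hRep_eq_one`, `eq_zero_of_mem_of_natDegree_lt`), the
  homomorphism **`hMapK n d v hv : K_n(F[t]/(π)) →+ K_{n+1}F(t)/L_d`** (`deg π = d + 1`) and its values on ARBITRARY
  representatives **`hMapK_symbol_residueClassUnit`** (through `symbol_cons_sub_mem_of_mk_eq`).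
* §3 **LEMMA 2.5, generation**: the top generators `topSymbolsK`/`topPartK` («products l(f₁)l(g₂)⋯l(gₙ) where only f₁
  has degree d … f₁ = aπ»), Lemma 1.2 at two arbitrary slots `symbol_eq_symbol_update_neg_one_of_eq`, the atoms
  (`mem_atomsBelow_succ_cases`, `monicGen_sub_monicGen`), the induction on `s` **`symbol_mem_sup_of_card`** (five-term
  identity at two arbitrary slots), and **`filtrationK_succ_le : L_{d+1} ≤ L_d ⊔ topPartK d`** / `filtrationK_succ_eq`.

Not here (sequel rows g40-#3/#4): the boundary maps `∂_𝔭` on `K_{n+1}F(t)`, «∂_π ∘ h_π = identity or zero» (the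
injectivity half of Lemma 2.5), the direct sum, exactness and THEOREM 2.3.

## References

* [Milnor1970] J. Milnor, *Algebraic K-theory and quadratic forms*, Invent. Math. 9 (1970) 318–344 — §2 Theorem 2.3
  (p0008 L12–L16), its proof (p0008 L17–L27, p0010 L9–L12), Lemma 2.4 (p0008 L28 – p0009 L21), Lemma 2.5 (p0009 L22 –
  p0010 L12); §1 Lemmas 1.1/1.2 (p0002 L33–L50).

Provenance: lane `lit-hodgefound`, seat `lit-hodgefound-p27` gen 40 (agent `literature-prover-lit-hodgefound-p27-g40-0`),
row g40-#2.
-/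

set_option autoImplicit false

noncomputable section

namespace Literature.RingTheory.KTheory

namespace MilnorK

open Function Polynomial IsDedekindDomain

/-! ### §0 multilinearity on generated subgroups -/

section Closure

variable {R : Type*} [CommRing R] {n : ℕ}

/-- **Multilinearity on generated subgroups, slot by slot**: if `{a}` lies in the subgroup `M` whenever each `aⱼ` lies in `Sⱼ`, then also whenever each `aⱼ` lies in the group generated by `Sⱼ` («the subgroup generated by those products l(f₁)⋯l(fₙ) such that …» — quotients of polynomials come for free). [cite: Milnor1970, §2 proof of Theorem 2.3 (p0008 L16–L23)] -/
theorem symbol_mem_of_forall_mem_closure (S : Fin n → Set Rˣ) (M : AddSubgroup (MilnorK R n))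
    (hM : ∀ a : Fin n → Rˣ, (∀ j, a j ∈ S j) → symbol a ∈ M) (a : Fin n → Rˣ)
    (ha : ∀ j, a j ∈ Subgroup.closure (S j)) : symbol a ∈ M := by
  -- `P k`: slots `< k` may be in the closure, slots `≥ k` in `S`
  suffices P : ∀ k : ℕ, ∀ b : Fin n → Rˣ, (∀ j : Fin n, j.val < k → b j ∈ Subgroup.closure (S j)) →
      (∀ j : Fin n, k ≤ j.val → b j ∈ S j) → symbol b ∈ M from
    P n a (fun j _ => ha j) (fun j hj => absurd (lt_of_lt_of_le j.isLt hj) (lt_irrefl _))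
  intro k
  induction k with
  | zero => exact fun b _ hb => hM b fun j => hb j (Nat.zero_le _)
  | succ k ih =>
    intro b hlt hge
    by_cases hk : k < n
    · set jk : Fin n := ⟨k, hk⟩ with hjk
      -- the good set at slot `k` is a subgroup containing `S jk`
      have hsub : ∀ y ∈ Subgroup.closure (S jk), symbol (update b jk y) ∈ M := by
        intro y hy
        induction hy using Subgroup.closure_induction with
        | mem x hx =>
          refine ih _ (fun j hj => ?_) (fun j hj => ?_)
          · rw [update_of_ne (fun h => by subst h; exact absurd hj (lt_irrefl _))]
            exact hlt j (Nat.lt_succ_of_lt hj)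
          · by_cases hjj : j = jk
            · subst hjj; rw [update_self]; exact hx
            · rw [update_of_ne hjj]
              exact hge j (lt_of_le_of_ne hj fun h => hjj (Fin.ext (by rw [hjk]; exact h.symm)))
        | one => rw [symbol_update_one]; exact M.zero_mem
        | mul x y _ _ hx hy => rw [symbol_update_mul]; exact M.add_mem hx hy
        | inv x _ hx => rw [symbol_update_inv]; exact M.neg_mem hx
      have := hsub (b jk) (hlt jk (by simp [hjk]))
      rwa [update_eq_self] at this
    · exact ih b (fun j hj => hlt j (Nat.lt_succ_of_lt hj)) fun j hj =>
        absurd (lt_of_lt_of_le j.isLt (le_trans (not_lt.1 hk) hj)) (lt_irrefl _)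

end Closure

/-! ### §1 the filtration of `K_{n}F(t)` -/

section Filtration

variable (F : Type*) [Field F] (n : ℕ)

/-- The generators of `L_d`: the symbols `{f₁, …, fₙ}` of non-zero polynomials of degree `≤ d`. [cite: Milnor1970, §2 proof of Theorem 2.3 (p0008 L16–L23)] -/
def symbolsBelowK (d : ℕ) : Set (MilnorK (RatFunc F) n) :=
  {z | ∃ a : Fin n → (RatFunc F)ˣ, (∀ j, a j ∈ polyUnitsBelow F d) ∧ z = symbol a}

/-- **Milnor's `L_d ⊂ K_nF(t)`**: «the subgroup generated by those products l(f₁)⋯l(fₙ) such that f₁, …, fₙ ∈ F[t] are polynomials of degree ≤ d». [cite: Milnor1970, §2 proof of Theorem 2.3 (p0008 L16–L23)] -/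
def filtrationK (d : ℕ) : AddSubgroup (MilnorK (RatFunc F) n) := AddSubgroup.closure (symbolsBelowK F n d)

variable {F n}

/-- The generators lie in `L_d`. [cite: Milnor1970, §2 proof of Theorem 2.3 (p0008 L16–L23)] -/
theorem symbol_mem_filtrationK {d : ℕ} (a : Fin n → (RatFunc F)ˣ) (ha : ∀ j, a j ∈ polyUnitsBelow F d) :
    symbol a ∈ filtrationK F n d :=
  AddSubgroup.subset_closure ⟨a, ha, rfl⟩

/-- `{f₁, …, fₙ} ∈ L_d` for polynomials of degree `≤ d`. [cite: Milnor1970, §2 proof of Theorem 2.3 (p0008 L16–L23)] -/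
theorem symbol_polyUnit_mem_filtrationK {d : ℕ} (f : Fin n → F[X]) (hf : ∀ j, f j ≠ 0) (hd : ∀ j, (f j).natDegree ≤ d) :
    symbol (fun j => polyUnit F (f j) (hf j)) ∈ filtrationK F n d :=
  symbol_mem_filtrationK _ fun j => polyUnit_mem_polyUnitsBelow F (hf j) (hd j)

/-- **«L₀ ⊂ L₁ ⊂ L₂ ⊂ …»**. [cite: Milnor1970, §2 proof of Theorem 2.3 (p0008 L16–L23)] -/
theorem filtrationK_mono : Monotone (filtrationK F n) := fun _ _ h =>
  AddSubgroup.closure_mono (by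
    rintro z ⟨a, ha, rfl⟩
    exact ⟨a, fun j => polyUnitsBelow_mono F h (ha j), rfl⟩)

/-- `L_d` contains `{x₁, …, xₙ}` for `xⱼ` in the group generated by the polynomials of degree `≤ d`. [cite: Milnor1970, §2 proof of Theorem 2.3 (p0008 L16–L23)] -/
theorem symbol_mem_filtrationK_of_mem_closure {d : ℕ} (a : Fin n → (RatFunc F)ˣ)
    (ha : ∀ j, a j ∈ Subgroup.closure (polyUnitsBelow F d)) : symbol a ∈ filtrationK F n d :=
  symbol_mem_of_forall_mem_closure (fun _ => polyUnitsBelow F d) _ (fun b hb => symbol_mem_filtrationK b hb) a ha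

/-- Every symbol lies in some `L_d`. [cite: Milnor1970, §2 proof of Theorem 2.3 «with union K_nF(t)» (p0008 L18–L19)] -/
theorem exists_symbol_mem_filtrationK (a : Fin n → (RatFunc F)ˣ) : ∃ d : ℕ, symbol a ∈ filtrationK F n d := by
  choose d hd using fun j => exists_mem_closure_polyUnitsBelow F (a j)
  refine ⟨Finset.univ.sup d, symbol_mem_filtrationK_of_mem_closure a fun j => ?_⟩
  exact Subgroup.closure_mono (polyUnitsBelow_mono F (Finset.le_sup (Finset.mem_univ j))) (hd j)

/-- **«with union K_nF(t)»**: `⨆_d L_d = K_nF(t)`. [cite: Milnor1970, §2 proof of Theorem 2.3 (p0008 L18–L19)] -/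
theorem iSup_filtrationK_eq_top : (⨆ d, filtrationK F n d) = ⊤ := by
  rw [eq_top_iff]
  rintro z -
  induction z using induction_on with
  | hsym k a =>
    obtain ⟨d, hd⟩ := exists_symbol_mem_filtrationK a
    exact AddSubgroup.zsmul_mem _ (AddSubgroup.mem_iSup_of_mem d hd) k
  | hadd x y hx hy => exact AddSubgroup.add_mem _ hx hy

/-- **«with union K_nF(t)»**: every element lies in some `L_d`. [cite: Milnor1970, §2 proof of Theorem 2.3 (p0008 L18–L19)] -/
theorem exists_mem_filtrationK (z : MilnorK (RatFunc F) n) : ∃ d : ℕ, z ∈ filtrationK F n d := by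
  have hz : z ∈ ⨆ d, filtrationK F n d := by rw [iSup_filtrationK_eq_top]; exact AddSubgroup.mem_top z
  exact (AddSubgroup.mem_iSup_of_directed (filtrationK_mono (F := F) (n := n)).directed_le).1 hz

variable (F n) in
/-- **`K_nF → K_nF(t)`**, induced by the inclusion `F ⊂ F(t)` (the first map of the exact sequence of Theorem 2.3). [cite: Milnor1970, §2 Theorem 2.3 «0 → K_nF → K_nF(t)» (p0008 L12–L13)] -/
def constMap : MilnorK F n →+ MilnorK (RatFunc F) n := MilnorK.map (algebraMap F (RatFunc F))

/-- `K_nF → K_nF(t)` on symbols. [cite: Milnor1970, §2 Theorem 2.3 (p0008 L12–L13)] -/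
theorem constMap_symbol (a : Fin n → Fˣ) :
    constMap F n (symbol a) = symbol (fun j => Units.map (algebraMap F (RatFunc F) : F →* RatFunc F) (a j)) :=
  MilnorK.map_symbol _ a

/-- **`L₀ ⊆ K_nF`**: «L₀ is … naturally isomorphic to K_nF» — `L₀` lies in the image of `K_nF`. [cite: Milnor1970, §2 proof of Theorem 2.3 (p0008 L20–L23)] -/
theorem filtrationK_zero_le_range_constMap : filtrationK F n 0 ≤ (constMap F n).range := by
  rw [filtrationK, AddSubgroup.closure_le]
  rintro z ⟨a, ha, rfl⟩
  have h : ∀ j, ∃ c : Fˣ, a j = Units.map (algebraMap F (RatFunc F) : F →* RatFunc F) c := by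
    intro j
    obtain ⟨g, hg, hdg, hga⟩ := ha j
    obtain ⟨c, hc, hgc⟩ := polyUnit_eq_map_of_natDegree_eq_zero F hg (Nat.le_zero.1 hdg)
    exact ⟨Units.mk0 c hc, by rw [← hga, hgc]⟩
  choose c hc using h
  refine ⟨symbol c, ?_⟩
  rw [constMap_symbol]
  congr 1; funext j; exact (hc j).symm

end Filtration

/-! ### §2 LEMMA 2.4 -/

section Lemma24

variable {F : Type*} [Field F] {n : ℕ}

/-- The monic generator `π` of the prime `𝔭 = (π)` as a unit of `F(t)`. [cite: Milnor1970, §2 «Let π be a monic irreducible polynomial of degree d» (p0008 L25)] -/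
abbrev genUnit (F : Type*) [Field F] (v : HeightOneSpectrum F[X]) : (RatFunc F)ˣ :=
  polyUnit F (monicGen F v) (monicGen_ne_zero F v)

/-- `(x, G[j ↦ y]) = (x, G)[j+1 ↦ y]`. [cite: Milnor1970, §2 proof of Lemma 2.4 «as a function of g₂» (p0008 L35–L36)] -/
theorem cons_update_eq {α : Type*} (x : α) (G : Fin n → α) (j : Fin n) (y : α) :
    (Fin.cons x (update G j y) : Fin (n + 1) → α) = update (Fin.cons x G) j.succ y := by
  funext k
  refine Fin.cases ?_ (fun i => ?_) k
  · rw [Fin.cons_zero, update_of_ne (Fin.succ_ne_zero j).symm, Fin.cons_zero]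
  · rw [Fin.cons_succ]
    by_cases hi : i = j
    · subst hi; rw [update_self, update_self]
    · rw [update_of_ne hi, update_of_ne (fun h => hi (Fin.succ_inj.1 h)), Fin.cons_succ]

/-- All entries of `(x, G)` lie in a subgroup when `x` and the `Gⱼ` do. [cite: Milnor1970, §2 proof of Theorem 2.3 (p0008 L16–L23)] -/
theorem cons_mem_closure {S : Set (RatFunc F)ˣ} {x : (RatFunc F)ˣ} (hx : x ∈ Subgroup.closure S) {G : Fin n → (RatFunc F)ˣ}
    (hG : ∀ j, G j ∈ Subgroup.closure S) : ∀ j, (Fin.cons x G : Fin (n + 1) → (RatFunc F)ˣ) j ∈ Subgroup.closure S :=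
  fun j => Fin.cases (by rw [Fin.cons_zero]; exact hx) (fun k => by rw [Fin.cons_succ]; exact hG k) j

/-- **LEMMA 2.4, the linearity at an arbitrary slot** («Suppose that ḡ₂ = ḡ₂′ḡ₂″ mod (π), where g₂, g₂′, g₂″ are polynomials of degree < d. Then g₂ = πf + g₂′g₂″ where f is also a polynomial of degree < d. Hence, if f ≠ 0, 1 = πf/g₂ + g₂′g₂″/g₂ and therefore (l(π) + l(f) − l(g₂))(l(g₂′) + l(g₂″) − l(g₂)) = 0. Multiplying on the right by l(g₃)⋯l(gₙ), and then reducing modulo L_{d−1}, we obtain l(π)(l(g₂′) + l(g₂″) − l(g₂))l(g₃)⋯l(gₙ) = 0. Since the case f = 0 is straightforward, this proves that our correspondence is (n−1)-linear»): `{π, …, g′, …} + {π, …, g″, …} − {π, …, g, …} ∈ L_d` for `deg π = d + 1`. [cite: Milnor1970, §2 proof of Lemma 2.4 (p0008 L32 – p0009 L16)] -/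
theorem symbol_cons_monicGen_linear_mem {d : ℕ} (v : HeightOneSpectrum F[X]) (hv : primeDeg F v = d + 1)
    (G : Fin n → (RatFunc F)ˣ) (hG : ∀ j, G j ∈ Subgroup.closure (polyUnitsBelow F d)) (j : Fin n)
    {g g' g'' : F[X]} (hg : g ≠ 0) (hg' : g' ≠ 0) (hg'' : g'' ≠ 0) (hdg : g.natDegree ≤ d) (hdg' : g'.natDegree ≤ d)
    (hdg'' : g''.natDegree ≤ d)
    (hmod : Ideal.Quotient.mk v.asIdeal g = Ideal.Quotient.mk v.asIdeal g' * Ideal.Quotient.mk v.asIdeal g'') :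
    symbol (Fin.cons (genUnit F v) (update G j (polyUnit F g' hg')) : Fin (n + 1) → (RatFunc F)ˣ) +
        symbol (Fin.cons (genUnit F v) (update G j (polyUnit F g'' hg'')) : Fin (n + 1) → (RatFunc F)ˣ) -
        symbol (Fin.cons (genUnit F v) (update G j (polyUnit F g hg)) : Fin (n + 1) → (RatFunc F)ˣ) ∈
      filtrationK F (n + 1) d := by
  set π : F[X] := monicGen F v with hπdef
  have hπ0 : π ≠ 0 := monicGen_ne_zero F v
  -- `g − g′g″ = π f`
  have hdvd : π ∣ g - g' * g'' := by
    rw [hπdef, ← mem_iff_monicGen_dvd, ← Ideal.Quotient.eq, hmod, map_mul]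
  obtain ⟨f, hf⟩ := hdvd
  by_cases hf0 : f = 0
  · -- `g = g′g″`
    have hgeq : g = g' * g'' := by rw [hf0, mul_zero, sub_eq_zero] at hf; exact hf
    have hunit : polyUnit F g hg = polyUnit F g' hg' * polyUnit F g'' hg'' := by
      rw [← polyUnit_mul]; exact Units.ext (by simp only [coe_polyUnit, hgeq])
    rw [hunit, cons_update_eq, cons_update_eq, cons_update_eq, symbol_update_mul, sub_self]
    exact AddSubgroup.zero_mem _
  · have hdf : f.natDegree ≤ d := by
      have h1 : (π * f).natDegree = (d + 1) + f.natDegree := by rw [natDegree_mul hπ0 hf0, ← hv, primeDeg]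
      have h2 : (g - g' * g'').natDegree ≤ max g.natDegree (g' * g'').natDegree := natDegree_sub_le _ _
      have h3 : (g' * g'').natDegree ≤ d + d := natDegree_mul_le.trans (add_le_add hdg' hdg'')
      rw [hf] at h2
      omega
    -- `A = π f/g`, `B = g′g″/g`, `A + B = 1`
    set Q : (RatFunc F)ˣ := polyUnit F f hf0 * (polyUnit F g hg)⁻¹ with hQ
    set B : (RatFunc F)ˣ := polyUnit F g' hg' * polyUnit F g'' hg'' * (polyUnit F g hg)⁻¹ with hB
    have hga : algebraMap F[X] (RatFunc F) g ≠ 0 := (polyUnit F g hg).ne_zero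
    have hAB : ((genUnit F v * Q : (RatFunc F)ˣ) : RatFunc F) + B = 1 := by
      have hgsum : g = π * f + g' * g'' := by rw [← hf]; ring
      rw [hQ, hB]
      simp only [Units.val_mul, Units.val_inv_eq_inv_val, coe_polyUnit]
      rw [← _root_.mul_assoc, ← add_mul, ← map_mul, ← map_mul, ← hπdef, ← map_add, ← hgsum, mul_inv_cancel₀ hga]
    -- the relation `{πQ, …, B@j+1, …} = 0`
    have hmemQ : Q ∈ Subgroup.closure (polyUnitsBelow F d) :=
      mul_mem (Subgroup.subset_closure (polyUnit_mem_polyUnitsBelow F hf0 hdf))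
        (inv_mem (Subgroup.subset_closure (polyUnit_mem_polyUnitsBelow F hg hdg)))
    have hmemB : B ∈ Subgroup.closure (polyUnitsBelow F d) :=
      mul_mem (mul_mem (Subgroup.subset_closure (polyUnit_mem_polyUnitsBelow F hg' hdg'))
        (Subgroup.subset_closure (polyUnit_mem_polyUnitsBelow F hg'' hdg'')))
        (inv_mem (Subgroup.subset_closure (polyUnit_mem_polyUnitsBelow F hg hdg)))
    have hrel : symbol (Fin.cons (genUnit F v * Q) (update G j B) : Fin (n + 1) → (RatFunc F)ˣ) = 0 := by
      refine symbol_eq_zero_of_add_eq_one_of_ne _ (i := 0) (j := j.succ) (Fin.succ_ne_zero j).symm ?_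
      rw [Fin.cons_zero, Fin.cons_succ, update_self]
      exact hAB
    rw [← cons_symbol, cons_mul, cons_symbol, cons_symbol, add_eq_zero_iff_eq_neg] at hrel
    have hmem : symbol (Fin.cons (genUnit F v) (update G j B) : Fin (n + 1) → (RatFunc F)ˣ) ∈ filtrationK F (n + 1) d := by
      rw [hrel]
      refine AddSubgroup.neg_mem _ (symbol_mem_filtrationK_of_mem_closure _ (cons_mem_closure hmemQ fun i => ?_))
      by_cases hij : i = j
      · subst hij; rw [update_self]; exact hmemB
      · rw [update_of_ne hij]; exact hG i
    rw [hB, cons_update_eq, symbol_update_mul, symbol_update_mul, symbol_update_inv, ← sub_eq_add_neg] at hmem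
    rw [cons_update_eq, cons_update_eq, cons_update_eq]
    exact hmem

/-- A polynomial of `(π)` of degree `< deg π` is zero («represented by a unique polynomial g ∈ F[t] of degree < d»). [cite: Milnor1970, §2 before Lemma 2.4 (p0008 L25–L27)] -/
theorem eq_zero_of_mem_of_natDegree_lt (v : HeightOneSpectrum F[X]) {g : F[X]} (hgv : g ∈ v.asIdeal)
    (hg : g.natDegree < primeDeg F v) : g = 0 := by
  by_contra h0
  exact not_mem_of_natDegree_lt F v h0 hg hgv

/-- The chosen representative `g_u` of degree `< deg π` of `u ∈ (F[t]/π)•`, as a unit of `F(t)`. [cite: Milnor1970, §2 before Lemma 2.4 «each element ḡ of the quotient F[t]/(π) is represented by a unique polynomial g ∈ F[t] of degree < d» (p0008 L25–L27)] -/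
def repUnit (v : HeightOneSpectrum F[X]) (u : (F[X] ⧸ v.asIdeal)ˣ) : (RatFunc F)ˣ :=
  polyUnit F (hRep F v u) (hRep_ne_zero F v u)

/-- The representative has degree `≤ d` (`deg π = d + 1`). [cite: Milnor1970, §2 before Lemma 2.4 (p0008 L25–L27)] -/
theorem repUnit_mem (v : HeightOneSpectrum F[X]) {d : ℕ} (hv : primeDeg F v = d + 1) (u : (F[X] ⧸ v.asIdeal)ˣ) :
    repUnit v u ∈ polyUnitsBelow F d := by
  have h := natDegree_hRep_lt F v u
  rw [hv] at h
  exact polyUnit_mem_polyUnitsBelow F _ (Nat.lt_succ_iff.1 h)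

/-- The tuple `(π, g_{u₁}, …, g_{uₙ})` of Lemma 2.4. [cite: Milnor1970, §2 Lemma 2.4 «the residue class of l(π)l(g₂)⋯l(gₙ)» (p0008 L28–L31)] -/
def hTuple (v : HeightOneSpectrum F[X]) (m : Fin n → Additive (F[X] ⧸ v.asIdeal)ˣ) : Fin (n + 1) → (RatFunc F)ˣ :=
  Fin.cons (genUnit F v) fun j => repUnit v (Additive.toMul (m j))

/-- Updating one residue updates one representative. [cite: Milnor1970, §2 proof of Lemma 2.4 (p0008 L32–L36)] -/
theorem hTuple_update (v : HeightOneSpectrum F[X]) (m : Fin n → Additive (F[X] ⧸ v.asIdeal)ˣ) (i : Fin n)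
    (z : Additive (F[X] ⧸ v.asIdeal)ˣ) :
    hTuple v (update m i z) = update (hTuple v m) i.succ (repUnit v (Additive.toMul z)) := by
  rw [hTuple, hTuple, ← cons_update_eq]
  congr 1
  funext j
  by_cases hj : j = i
  · subst hj; rw [update_self, update_self]
  · rw [update_of_ne hj, update_of_ne hj]

variable (d : ℕ) in
/-- The correspondence `(ḡ₁, …, ḡₙ) ↦ [l(π)l(g₁)⋯l(gₙ)] mod L_d`. [cite: Milnor1970, §2 proof of Lemma 2.4 «First consider the correspondence …» (p0008 L32–L35)] -/
def hFun (v : HeightOneSpectrum F[X]) (m : Fin n → Additive (F[X] ⧸ v.asIdeal)ˣ) :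
    MilnorK (RatFunc F) (n + 1) ⧸ filtrationK F (n + 1) d :=
  QuotientAddGroup.mk (symbol (hTuple v m))

/-- Unfolding `hFun`. [cite: Milnor1970, §2 proof of Lemma 2.4 (p0008 L32–L35)] -/
theorem hFun_def {d : ℕ} (v : HeightOneSpectrum F[X]) (m : Fin n → Additive (F[X] ⧸ v.asIdeal)ˣ) :
    hFun d v m = QuotientAddGroup.mk (symbol (hTuple v m)) := rfl

/-- **«this correspondence is linear, for example as a function of g₂»**. [cite: Milnor1970, §2 proof of Lemma 2.4 (p0008 L35 – p0009 L16)] -/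
theorem hFun_update_add {d : ℕ} (v : HeightOneSpectrum F[X]) (hv : primeDeg F v = d + 1)
    (m : Fin n → Additive (F[X] ⧸ v.asIdeal)ˣ) (i : Fin n) (x y : Additive (F[X] ⧸ v.asIdeal)ˣ) :
    hFun d v (update m i (x + y)) = hFun d v (update m i x) + hFun d v (update m i y) := by
  rw [hFun_def, hFun_def, hFun_def, hTuple_update, hTuple_update, hTuple_update, ← QuotientAddGroup.mk_add, eq_comm,
    QuotientAddGroup.eq_iff_sub_mem, hTuple, ← cons_update_eq, ← cons_update_eq, ← cons_update_eq]
  have hG : ∀ j, repUnit v (Additive.toMul (m j)) ∈ Subgroup.closure (polyUnitsBelow F d) :=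
    fun j => Subgroup.subset_closure (repUnit_mem v hv _)
  have hlt := fun u => natDegree_hRep_lt F v u
  simp_rw [hv] at hlt
  exact symbol_cons_monicGen_linear_mem v hv _ hG i (hRep_ne_zero F v _) (hRep_ne_zero F v _) (hRep_ne_zero F v _)
    (Nat.lt_succ_iff.1 (hlt _)) (Nat.lt_succ_iff.1 (hlt _)) (Nat.lt_succ_iff.1 (hlt _))
    (by rw [mk_hRep, mk_hRep, mk_hRep, toMul_add, Units.val_mul])

/-- The correspondence in one slot, as an additive homomorphism. [cite: Milnor1970, §2 proof of Lemma 2.4 (p0008 L35 – p0009 L16)] -/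
def hFunSlot {d : ℕ} (v : HeightOneSpectrum F[X]) (hv : primeDeg F v = d + 1)
    (m : Fin n → Additive (F[X] ⧸ v.asIdeal)ˣ) (i : Fin n) :
    Additive (F[X] ⧸ v.asIdeal)ˣ →+ MilnorK (RatFunc F) (n + 1) ⧸ filtrationK F (n + 1) d :=
  AddMonoidHom.mk' (fun z => hFun d v (update m i z)) fun x y => hFun_update_add v hv m i x y

/-- Unfolding `hFunSlot`. [cite: Milnor1970, §2 proof of Lemma 2.4 (p0008 L35 – p0009 L16)] -/
theorem hFunSlot_apply {d : ℕ} (v : HeightOneSpectrum F[X]) (hv : primeDeg F v = d + 1)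
    (m : Fin n → Additive (F[X] ⧸ v.asIdeal)ˣ) (i : Fin n) (z : Additive (F[X] ⧸ v.asIdeal)ˣ) :
    hFunSlot v hv m i z = hFun d v (update m i z) := rfl

/-- `ℤ`-linearity in one slot (from additivity). [cite: Milnor1970, §2 proof of Lemma 2.4 (p0008 L35 – p0009 L16)] -/
theorem hFun_update_zsmul {d : ℕ} (v : HeightOneSpectrum F[X]) (hv : primeDeg F v = d + 1)
    (m : Fin n → Additive (F[X] ⧸ v.asIdeal)ˣ) (i : Fin n) (c : ℤ) (x : Additive (F[X] ⧸ v.asIdeal)ˣ) :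
    hFun d v (update m i (c • x)) = c • hFun d v (update m i x) := by
  rw [← hFunSlot_apply v hv, ← hFunSlot_apply v hv, map_zsmul]

variable (d : ℕ) in
/-- The correspondence as an `n`-linear map on `(K₁F[t]/(π))ⁿ` («this proves that our correspondence is (n−1)-linear»). [cite: Milnor1970, §2 proof of Lemma 2.4 (p0009 L16)] -/
def hMulti (v : HeightOneSpectrum F[X]) (hv : primeDeg F v = d + 1) :
    MultilinearMap ℤ (fun _ : Fin n => Additive (F[X] ⧸ v.asIdeal)ˣ) (MilnorK (RatFunc F) (n + 1) ⧸ filtrationK F (n + 1) d) where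
  toFun := hFun d v
  map_update_add' m i x y := by convert hFun_update_add v hv m i x y
  map_update_smul' m i c x := by convert hFun_update_zsmul v hv m i c x

/-- Unfolding `hMulti`. [cite: Milnor1970, §2 proof of Lemma 2.4 (p0008 L32–L35)] -/
theorem hMulti_apply {d : ℕ} (v : HeightOneSpectrum F[X]) (hv : primeDeg F v = d + 1)
    (m : Fin n → Additive (F[X] ⧸ v.asIdeal)ˣ) : hMulti d v hv m = QuotientAddGroup.mk (symbol (hTuple v m)) := rfl

/-- **«the image is zero whenever ḡⱼ + ḡⱼ₊₁ = 1 and hence gⱼ + gⱼ₊₁ = 1»** — representatives of degree `< deg π` summing to `1̄` sum to `1`. [cite: Milnor1970, §2 proof of Lemma 2.4 (p0009 L17–L21)] -/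
theorem hRep_add_hRep_eq_one (v : HeightOneSpectrum F[X]) {u u' : (F[X] ⧸ v.asIdeal)ˣ}
    (h : (u : F[X] ⧸ v.asIdeal) + u' = 1) : hRep F v u + hRep F v u' = 1 := by
  have hmem : hRep F v u + hRep F v u' - 1 ∈ v.asIdeal := by
    rw [← Ideal.Quotient.eq_zero_iff_mem, map_sub, map_add, mk_hRep, mk_hRep, map_one, h, sub_self]
  have hdeg : (hRep F v u + hRep F v u' - 1).natDegree < primeDeg F v := by
    refine lt_of_le_of_lt (natDegree_sub_le _ _) ?_
    rw [natDegree_one, Nat.max_zero]  -- max _ 0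
    exact lt_of_le_of_lt (natDegree_add_le _ _) (max_lt (natDegree_hRep_lt F v u) (natDegree_hRep_lt F v u'))
  have := eq_zero_of_mem_of_natDegree_lt v hmem hdeg
  rwa [sub_eq_zero] at this

variable (n d) in
/-- **LEMMA 2.4: the homomorphism `h_π : K_n(F[t]/(π)) → L_{d+1}/L_d ⊂ K_{n+1}F(t)/L_d`** («There exists one and only one homomorphism h_π : K_{n−1}F[t]/(π) → L_d/L_{d−1} which carries each product l(ḡ₂)⋯l(ḡₙ) to the residue class of l(π)l(g₂)⋯l(gₙ) modulo L_{d−1}»; here `deg π = d + 1`, symbols of length `n` to length `n + 1`; uniqueness is `MilnorK.hom_ext`). [cite: Milnor1970, §2 Lemma 2.4 (p0008 L28–L31), proof (p0008 L32 – p0009 L21)] -/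
def hMapK (v : HeightOneSpectrum F[X]) (hv : primeDeg F v = d + 1) :
    MilnorK (F[X] ⧸ v.asIdeal) n →+ MilnorK (RatFunc F) (n + 1) ⧸ filtrationK F (n + 1) d :=
  lift (hMulti d v hv) (by
    intro a i h hsum
    rw [hMulti_apply, QuotientAddGroup.eq_zero_iff]
    have h1 : hRep F v (a i) + hRep F v (a (finSucc i h)) = 1 := hRep_add_hRep_eq_one v hsum
    have h0 : symbol (hTuple v (fun k => Additive.ofMul (a k))) = 0 := by
      refine symbol_eq_zero_of_add_eq_one _ i.succ (succ_val_add_one_lt h) ?_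
      rw [finSucc_succ i h, hTuple, Fin.cons_succ, Fin.cons_succ, toMul_ofMul, toMul_ofMul, repUnit, repUnit, coe_polyUnit,
        coe_polyUnit, ← map_add, h1, map_one]
    rw [h0]; exact AddSubgroup.zero_mem _)

/-- `h_π{u} = [{π, g_u}]` with the chosen representatives. [cite: Milnor1970, §2 Lemma 2.4 (p0008 L28–L31)] -/
theorem hMapK_symbol {d : ℕ} (v : HeightOneSpectrum F[X]) (hv : primeDeg F v = d + 1) (a : Fin n → (F[X] ⧸ v.asIdeal)ˣ) :
    hMapK n d v hv (symbol a) =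
      QuotientAddGroup.mk (symbol (Fin.cons (genUnit F v) (fun j => repUnit v (a j)) : Fin (n + 1) → (RatFunc F)ˣ)) := by
  rw [hMapK, lift_symbol, hMulti_apply]; rfl

/-- Changing ALL representatives within their residue classes changes `{π, g}` by an element of `L_d` (slot-by-slot application of the linearity with `g″ = 1`). [cite: Milnor1970, §2 proof of Lemma 2.4 (p0008 L32 – p0009 L16)] -/
theorem symbol_cons_sub_mem_of_mk_eq {d : ℕ} (v : HeightOneSpectrum F[X]) (hv : primeDeg F v = d + 1)
    (G G' : Fin n → F[X]) (h0 : ∀ j, G j ≠ 0) (h0' : ∀ j, G' j ≠ 0) (hd : ∀ j, (G j).natDegree ≤ d)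
    (hd' : ∀ j, (G' j).natDegree ≤ d) (hmk : ∀ j, Ideal.Quotient.mk v.asIdeal (G j) = Ideal.Quotient.mk v.asIdeal (G' j)) :
    symbol (Fin.cons (genUnit F v) (fun j => polyUnit F (G j) (h0 j)) : Fin (n + 1) → (RatFunc F)ˣ) -
        symbol (Fin.cons (genUnit F v) (fun j => polyUnit F (G' j) (h0' j)) : Fin (n + 1) → (RatFunc F)ˣ) ∈
      filtrationK F (n + 1) d := by
  -- `P k`: the tuples agree from slot `k` on
  suffices P : ∀ k : ℕ, ∀ (H H' : Fin n → F[X]) (hH : ∀ j, H j ≠ 0) (hH' : ∀ j, H' j ≠ 0), (∀ j, (H j).natDegree ≤ d) →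
      (∀ j, (H' j).natDegree ≤ d) → (∀ j, Ideal.Quotient.mk v.asIdeal (H j) = Ideal.Quotient.mk v.asIdeal (H' j)) →
      (∀ j : Fin n, k ≤ j.val → H j = H' j) →
      symbol (Fin.cons (genUnit F v) (fun j => polyUnit F (H j) (hH j)) : Fin (n + 1) → (RatFunc F)ˣ) -
        symbol (Fin.cons (genUnit F v) (fun j => polyUnit F (H' j) (hH' j)) : Fin (n + 1) → (RatFunc F)ˣ) ∈
      filtrationK F (n + 1) d from
    P n G G' h0 h0' hd hd' hmk fun j hj => absurd (lt_of_lt_of_le j.isLt hj) (lt_irrefl _)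
  intro k
  induction k with
  | zero =>
    intro H H' hH hH' _ _ _ heq
    have : (fun j => polyUnit F (H j) (hH j)) = fun j => polyUnit F (H' j) (hH' j) := by
      funext j; exact Units.ext (by simp only [coe_polyUnit, heq j (Nat.zero_le _)])
    rw [this, sub_self]; exact AddSubgroup.zero_mem _
  | succ k ih =>
    intro H H' hH hH' hdH hdH' hmk heq
    by_cases hk : k < n
    · set jk : Fin n := ⟨k, hk⟩ with hjk
      -- `H″ = H′` updated at slot `k` by `H k`
      set H'' : Fin n → F[X] := update H' jk (H jk) with hH''def
      have hH'' : ∀ j, H'' j ≠ 0 := fun j => by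
        by_cases hj : j = jk
        · subst hj; rw [hH''def, update_self]; exact hH _
        · rw [hH''def, update_of_ne hj]; exact hH' j
      have hdH'' : ∀ j, (H'' j).natDegree ≤ d := fun j => by
        by_cases hj : j = jk
        · subst hj; rw [hH''def, update_self]; exact hdH _
        · rw [hH''def, update_of_ne hj]; exact hdH' j
      have h1 := ih H H'' hH hH'' hdH hdH'' (fun j => by
          by_cases hj : j = jk
          · subst hj; rw [hH''def, update_self]
          · rw [hH''def, update_of_ne hj]; exact hmk j)
        (fun j hj => by
          by_cases hjj : j = jk
          · subst hjj; rw [hH''def, update_self]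
          · rw [hH''def, update_of_ne hjj]
            exact heq j (lt_of_le_of_ne hj fun h => hjj (Fin.ext (by rw [hjk]; exact h.symm))))
      -- `{π, H″} − {π, H′} ∈ L_d` by the linearity with `g″ = 1`
      set U' : Fin n → (RatFunc F)ˣ := fun j => polyUnit F (H' j) (hH' j) with hU'
      have hU'mem : ∀ j, U' j ∈ Subgroup.closure (polyUnitsBelow F d) :=
        fun j => Subgroup.subset_closure (polyUnit_mem_polyUnitsBelow F (hH' j) (hdH' j))
      have h2 := symbol_cons_monicGen_linear_mem v hv U' hU'mem jk (hH' jk) (hH jk) one_ne_zero (hdH' jk) (hdH jk)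
        (by rw [natDegree_one]; exact Nat.zero_le d) (by rw [map_one, _root_.mul_one]; exact (hmk jk).symm)
      have hone : polyUnit F (1 : F[X]) one_ne_zero = 1 := Units.ext (by rw [coe_polyUnit, map_one, Units.val_one])
      rw [hone, cons_update_eq _ _ _ (1 : (RatFunc F)ˣ), symbol_update_one, add_zero] at h2
      have e1 : (fun j => polyUnit F (H'' j) (hH'' j)) = update U' jk (polyUnit F (H jk) (hH jk)) := by
        funext j
        by_cases hj : j = jk
        · subst hj; rw [update_self]; exact Units.ext (by simp only [coe_polyUnit, hH''def, update_self])
        · rw [update_of_ne hj, hU']; exact Units.ext (by simp only [coe_polyUnit, hH''def, update_of_ne hj])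
      have e2 : U' = update U' jk (polyUnit F (H' jk) (hH' jk)) := by rw [hU', update_eq_self]
      rw [e1] at h1
      have h3 := AddSubgroup.add_mem _ h1 h2
      rwa [← e2, sub_add_sub_cancel] at h3
    · exact ih H H' hH hH' hdH hdH' hmk fun j hj =>
        heq j (by have := j.isLt; omega)

/-- **LEMMA 2.4, values: `h_π{ḡ₁, …, ḡₙ} = [{π, g₁, …, gₙ}]` for ANY non-zero representatives `gⱼ` of degree `≤ d`** («carries each product l(ḡ₂)⋯l(ḡₙ) to the residue class of l(π)l(g₂)⋯l(gₙ)»). [cite: Milnor1970, §2 Lemma 2.4 (p0008 L28–L31)] -/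
theorem hMapK_symbol_residueClassUnit {d : ℕ} (v : HeightOneSpectrum F[X]) (hv : primeDeg F v = d + 1)
    (g : Fin n → F[X]) (hg : ∀ j, g j ≠ 0) (hdg : ∀ j, (g j).natDegree ≤ d) :
    hMapK n d v hv (symbol fun j => residueClassUnit F v (g j)
        (not_mem_of_natDegree_lt F v (hg j) (by rw [hv]; exact Nat.lt_succ_of_le (hdg j)))) =
      QuotientAddGroup.mk (symbol (Fin.cons (genUnit F v) (fun j => polyUnit F (g j) (hg j)) : Fin (n + 1) → (RatFunc F)ˣ)) := by
  rw [hMapK_symbol, QuotientAddGroup.eq_iff_sub_mem]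
  have hlt := fun u => natDegree_hRep_lt F v u
  simp_rw [hv] at hlt
  exact symbol_cons_sub_mem_of_mk_eq v hv (fun j => hRep F v _) g (fun j => hRep_ne_zero F v _) hg
    (fun j => Nat.lt_succ_iff.1 (hlt _)) hdg (fun j => by rw [mk_hRep, coe_residueClassUnit])

end Lemma24

/-! ### §3 LEMMA 2.5, generation half -/

section Lemma25

variable {F : Type*} [Field F] {n : ℕ}

variable (F n) in
/-- The generators «l(f₁)l(g₂)⋯l(gₙ) where only f₁ has degree d … setting f₁ = aπ»: the symbols `{π, g₁, …, gₙ}` with `π` monic irreducible of degree `d + 1` and `deg gⱼ ≤ d`. [cite: Milnor1970, §2 proof of Lemma 2.5 (p0009 L31 – p0010 L12)] -/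
def topSymbolsK (d : ℕ) : Set (MilnorK (RatFunc F) (n + 1)) :=
  {z | ∃ (v : HeightOneSpectrum F[X]) (g : Fin n → (RatFunc F)ˣ), primeDeg F v = d + 1 ∧ (∀ j, g j ∈ polyUnitsBelow F d) ∧
    z = symbol (Fin.cons (genUnit F v) g : Fin (n + 1) → (RatFunc F)ˣ)}

variable (F n) in
/-- The subgroup generated by the `{π, g₁, …, gₙ}`, `deg π = d + 1`, `deg gⱼ ≤ d` — «the images of the homomorphisms h_π». [cite: Milnor1970, §2 proof of Lemma 2.5 (p0009 L31 – p0010 L12)] -/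
def topPartK (d : ℕ) : AddSubgroup (MilnorK (RatFunc F) (n + 1)) := AddSubgroup.closure (topSymbolsK F n d)

/-- The generators lie in `topPartK`. [cite: Milnor1970, §2 proof of Lemma 2.5 (p0009 L31 – p0010 L12)] -/
theorem symbol_cons_mem_topPartK {d : ℕ} (v : HeightOneSpectrum F[X]) (hv : primeDeg F v = d + 1)
    (g : Fin n → (RatFunc F)ˣ) (hg : ∀ j, g j ∈ polyUnitsBelow F d) :
    symbol (Fin.cons (genUnit F v) g : Fin (n + 1) → (RatFunc F)ˣ) ∈ topPartK F n d :=
  AddSubgroup.subset_closure ⟨v, g, hv, hg, rfl⟩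

/-- `{π, x₁, …, xₙ} ∈ topPartK` for `xⱼ` in the group generated by the polynomials of degree `≤ d`. [cite: Milnor1970, §2 proof of Lemma 2.5 (p0009 L31 – p0010 L12)] -/
theorem symbol_cons_mem_topPartK_of_mem_closure {d : ℕ} (v : HeightOneSpectrum F[X]) (hv : primeDeg F v = d + 1)
    (g : Fin n → (RatFunc F)ˣ) (hg : ∀ j, g j ∈ Subgroup.closure (polyUnitsBelow F d)) :
    symbol (Fin.cons (genUnit F v) g : Fin (n + 1) → (RatFunc F)ˣ) ∈ topPartK F n d := by
  refine symbol_mem_of_forall_mem_closure (Fin.cons {genUnit F v} fun _ => polyUnitsBelow F d) (topPartK F n d)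
    (fun c hc => ?_) _ (fun j => ?_)
  · have h0 : c 0 = genUnit F v := by have := hc 0; rwa [Fin.cons_zero, Set.mem_singleton_iff] at this
    rw [← Fin.cons_self_tail c, h0]
    exact symbol_cons_mem_topPartK v hv _ fun j => by have := hc j.succ; rwa [Fin.cons_succ] at this
  · refine Fin.cases ?_ (fun k => ?_) j
    · rw [Fin.cons_zero, Fin.cons_zero]; exact Subgroup.subset_closure rfl
    · rw [Fin.cons_succ, Fin.cons_succ]; exact hg k

/-- `π` is a polynomial of degree `≤ d + 1`. [cite: Milnor1970, §2 proof of Lemma 2.5 (p0009 L31 – p0010 L12)] -/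
theorem genUnit_mem_polyUnitsBelow {d : ℕ} (v : HeightOneSpectrum F[X]) (hv : primeDeg F v = d + 1) :
    genUnit F v ∈ polyUnitsBelow F (d + 1) :=
  polyUnit_mem_polyUnitsBelow F _ (by rw [← primeDeg, hv])

/-- `topPartK d ≤ L_{d+1}`. [cite: Milnor1970, §2 proof of Lemma 2.5 (p0009 L31 – p0010 L12)] -/
theorem topPartK_le_filtrationK_succ (d : ℕ) : topPartK F n d ≤ filtrationK F (n + 1) (d + 1) := by
  rw [topPartK, AddSubgroup.closure_le]
  rintro z ⟨v, g, hv, hg, rfl⟩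
  exact symbol_mem_filtrationK _ fun j => Fin.cases (by rw [Fin.cons_zero]; exact genUnit_mem_polyUnitsBelow v hv)
    (fun k => by rw [Fin.cons_succ]; exact polyUnitsBelow_mono F (Nat.le_succ d) (hg k)) j

/-- Lemma 1.2 at two arbitrary slots: if `aᵢ = aⱼ` (`i ≠ j`) then `{a} = {a[j ↦ −1]}` (used for two EQUAL top-degree entries). [cite: Milnor1970, §1 Lemma 1.2 (p0002 L48–L50); §2 proof of Lemma 2.5 (p0009 L31 – p0010 L2)] -/
theorem symbol_eq_symbol_update_neg_one_of_eq {m : ℕ} (a : Fin (m + 1) → (RatFunc F)ˣ) {i j : Fin (m + 1)} (hij : i ≠ j)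
    (heq : a i = a j) : symbol a = symbol (update a j (-1)) := by
  by_cases hi : i = 0
  · subst hi; exact symbol_eq_symbol_update_neg_one a (Ne.symm hij) heq.symm
  by_cases hj : j = 0
  · subst hj
    set c := a ∘ Equiv.swap 0 i with hc
    have hc0 : c i = c 0 := by
      simp only [hc, Function.comp_apply, Equiv.swap_apply_right, Equiv.swap_apply_left]; exact heq.symm
    have h1 : symbol c = -symbol a := symbol_comp_swap_of_ne a (Ne.symm hi)
    have h2 : symbol c = symbol (update c i (-1)) := symbol_eq_symbol_update_neg_one c hi hc0
    have h3 : update c i (-1) = update a 0 (-1) ∘ Equiv.swap 0 i := by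
      rw [hc, ← update_comp_eq_of_injective a (Equiv.swap 0 i).injective i (-1), Equiv.swap_apply_right]
    rw [h2, h3, symbol_comp_swap_of_ne _ (Ne.symm hi), neg_inj] at h1
    exact h1.symm
  · set c := a ∘ Equiv.swap 0 i with hc
    have hcj : c j = c 0 := by
      simp only [hc, Function.comp_apply, Equiv.swap_apply_left, Equiv.swap_apply_of_ne_of_ne hj (Ne.symm hij)]
      exact heq.symm
    have h1 : symbol c = -symbol a := symbol_comp_swap_of_ne a (Ne.symm hi)
    have h2 : symbol c = symbol (update c j (-1)) := symbol_eq_symbol_update_neg_one c hj hcj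
    have h3 : update c j (-1) = update a j (-1) ∘ Equiv.swap 0 i := by
      rw [hc, ← update_comp_eq_of_injective a (Equiv.swap 0 i).injective j (-1), Equiv.swap_apply_of_ne_of_ne hj (Ne.symm hij)]
    rw [h2, h3, symbol_comp_swap_of_ne _ (Ne.symm hi), neg_inj] at h1
    exact h1.symm

/-- `−1` is a (constant) polynomial of degree `≤ d`. [cite: Milnor1970, §2 proof of Lemma 2.5 (p0009 L31 – p0010 L12)] -/
theorem neg_one_mem_polyUnitsBelow (d : ℕ) : (-1 : (RatFunc F)ˣ) ∈ polyUnitsBelow F d := by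
  rw [← polyUnit_C_neg_one]
  exact polyUnit_mem_polyUnitsBelow F _ (by rw [natDegree_C]; exact Nat.zero_le d)

/-- An atom of degree `≤ d + 1` is either a polynomial of degree `≤ d` or a monic irreducible `π` of degree exactly `d + 1`. [cite: Milnor1970, §2 proof of Lemma 2.5 (p0009 L31 – p0010 L12)] -/
theorem mem_atomsBelow_succ_cases {d : ℕ} {x : (RatFunc F)ˣ} (hx : x ∈ atomsBelow F (d + 1)) :
    x ∈ polyUnitsBelow F d ∨ ∃ v : HeightOneSpectrum F[X], primeDeg F v = d + 1 ∧ genUnit F v = x := by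
  rcases hx with ⟨a, ha, rfl⟩ | ⟨p, hp, hm, hdp, rfl⟩
  · exact Or.inl (polyUnit_mem_polyUnitsBelow F _ (by rw [natDegree_C]; exact Nat.zero_le d))
  · rcases Nat.lt_or_ge p.natDegree (d + 1) with hlt | hge
    · exact Or.inl (polyUnit_mem_polyUnitsBelow F _ (Nat.lt_succ_iff.1 hlt))
    · refine Or.inr ⟨primeOf F p hp, ?_, Units.ext (by simp only [genUnit, coe_polyUnit, monicGen_primeOf F p hm hp])⟩
      rw [primeDeg, monicGen_primeOf F p hm hp]
      exact le_antisymm hdp hge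

/-- For two distinct monic irreducibles `p ≠ q` of degree `d + 1`, `g = q − p` is non-zero of degree `≤ d` («we can set f₂ = −af₁ + g with a ∈ F• and degree g < d»). [cite: Milnor1970, §2 proof of Lemma 2.5 (p0009 L31 – p0010 L12)] -/
theorem monicGen_sub_monicGen {d : ℕ} {v w : HeightOneSpectrum F[X]} (hv : primeDeg F v = d + 1) (hw : primeDeg F w = d + 1)
    (hvw : v ≠ w) : monicGen F w - monicGen F v ≠ 0 ∧ (monicGen F w - monicGen F v).natDegree ≤ d := by
  have hne : monicGen F w ≠ monicGen F v := fun h => hvw (by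
    rw [← primeOf_monicGen F v, ← primeOf_monicGen F w]
    exact HeightOneSpectrum.ext (by change Ideal.span {monicGen F v} = Ideal.span {monicGen F w}; rw [h]))
  have hr0 : monicGen F w - monicGen F v ≠ 0 := sub_ne_zero.2 hne
  refine ⟨hr0, ?_⟩
  have hdeg : (monicGen F w).degree = (monicGen F v).degree := by
    rw [degree_eq_natDegree (monicGen_ne_zero F w), degree_eq_natDegree (monicGen_ne_zero F v), ← primeDeg, ← primeDeg, hv, hw]
  have hlt : (monicGen F w - monicGen F v).degree < (monicGen F w).degree :=
    degree_sub_lt hdeg (monicGen_ne_zero F w) (by rw [(monic_monicGen F w).leadingCoeff, (monic_monicGen F v).leadingCoeff])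
  rw [degree_eq_natDegree (monicGen_ne_zero F w), degree_eq_natDegree hr0, ← primeDeg, hw] at hlt
  exact Nat.lt_succ_iff.1 (by exact_mod_cast hlt)

/-- **LEMMA 2.5, generation, the induction on the number `s` of top-degree entries** («Consider any generator of L_d, expressed as a product l(f₁)⋯l(f_s)l(g_{s+1})⋯l(gₙ) … If s ≥ 2 then we can set f₂ = −af₁ + g … Thus the product l(f₁)l(f₂) can be expressed as a sum of terms l(f₁)l(g) + l(g)l(f₂) − l(a)l(f₂) + l(a)l(g) − l(g)², each of which involves at most one polynomial of degree d. … It follows, by induction on s … If f₁ is irreducible, then setting f₁ = aπ this product evidently belongs to the image of h_π»): here the top entries sit at an arbitrary finite set `T` of slots (Lemma 1.1 moves a single one to the front; two equal ones are handled by Lemma 1.2, two distinct ones `p ≠ q` by the five-term identity from `q/(q−p) + (−p/(q−p)) = 1`). [cite: Milnor1970, §2 proof of Lemma 2.5 (p0009 L31 – p0010 L12)] -/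
theorem symbol_mem_sup_of_card (d : ℕ) : ∀ (s : ℕ) (a : Fin (n + 1) → (RatFunc F)ˣ) (T : Finset (Fin (n + 1))),
    T.card ≤ s → (∀ j ∈ T, ∃ v : HeightOneSpectrum F[X], primeDeg F v = d + 1 ∧ genUnit F v = a j) →
    (∀ j, j ∉ T → a j ∈ Subgroup.closure (polyUnitsBelow F d)) →
    symbol a ∈ filtrationK F (n + 1) d ⊔ topPartK F n d := by
  intro s
  induction s with
  | zero =>
    intro a T hT _ hlow
    have hT' : T = ∅ := Finset.card_eq_zero.1 (Nat.le_zero.1 hT)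
    exact le_sup_left (α := AddSubgroup (MilnorK (RatFunc F) (n + 1)))
      (symbol_mem_filtrationK_of_mem_closure a fun j => hlow j (by rw [hT']; exact Finset.notMem_empty j))
  | succ s ih =>
    intro a T hT htop hlow
    set M := filtrationK F (n + 1) d ⊔ topPartK F n d with hM
    have hneg1 : (-1 : (RatFunc F)ˣ) ∈ Subgroup.closure (polyUnitsBelow F d) :=
      Subgroup.subset_closure (neg_one_mem_polyUnitsBelow d)
    by_cases hTs : T.card ≤ s
    · exact ih a T hTs htop hlow
    -- pick a top slot `j₀`
    have hTne : T.Nonempty := Finset.card_pos.1 (by omega)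
    obtain ⟨j₀, hj₀⟩ := hTne
    by_cases hcard1 : T.card = 1
    · -- exactly one top entry: move it to the front
      have hT1 : T = {j₀} :=
        Finset.eq_singleton_iff_unique_mem.2 ⟨hj₀, fun k hk => Finset.card_le_one.1 hcard1.le k hk j₀ hj₀⟩
      obtain ⟨v, hv, hvj⟩ := htop j₀ hj₀
      have hlow' : ∀ k, k ≠ j₀ → a k ∈ Subgroup.closure (polyUnitsBelow F d) :=
        fun k hk => hlow k (by rw [hT1, Finset.mem_singleton]; exact hk)
      by_cases hj0 : j₀ = 0
      · subst hj0
        rw [← Fin.cons_self_tail a, ← hvj]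
        exact le_sup_right (α := AddSubgroup (MilnorK (RatFunc F) (n + 1)))
          (symbol_cons_mem_topPartK_of_mem_closure v hv _ fun j => hlow' _ (Fin.succ_ne_zero j))
      · set b := a ∘ Equiv.swap 0 j₀ with hb
        have h1 : symbol b = -symbol a := symbol_comp_swap_of_ne a (Ne.symm hj0)
        have hb0 : b 0 = genUnit F v := by simp only [hb, Function.comp_apply, Equiv.swap_apply_left]; exact hvj.symm
        have hbmem : symbol b ∈ topPartK F n d := by
          rw [← Fin.cons_self_tail b, hb0]
          refine symbol_cons_mem_topPartK_of_mem_closure v hv _ fun j => ?_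
          simp only [Fin.tail, hb, Function.comp_apply]
          refine hlow' _ fun h => ?_
          rw [Equiv.swap_apply_eq_iff, Equiv.swap_apply_right] at h
          exact Fin.succ_ne_zero j h
        have ha : symbol a = -symbol b := by rw [h1, neg_neg]
        rw [ha]
        exact AddSubgroup.neg_mem _ (le_sup_right (α := AddSubgroup (MilnorK (RatFunc F) (n + 1))) hbmem)
    · -- two distinct top slots `i ≠ j`
      have hlt : 1 < T.card := by have := Finset.card_pos.2 ⟨j₀, hj₀⟩; omega
      obtain ⟨i, hiT, hij0⟩ := Finset.exists_mem_ne hlt j₀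
      set j := j₀ with hjdef
      obtain ⟨vi, hvi, hai⟩ := htop i hiT
      obtain ⟨vj, hvj, haj⟩ := htop j hj₀
      have hcardi : (T.erase i).card ≤ s := by rw [Finset.card_erase_of_mem hiT]; omega
      have hcardj : (T.erase j).card ≤ s := by rw [Finset.card_erase_of_mem hj₀]; omega
      have hcardij : ((T.erase i).erase j).card ≤ s :=
        (Finset.card_le_card (Finset.erase_subset _ _)).trans hcardi
      -- tops and lows of updated tuples
      have htop_i : ∀ (z : (RatFunc F)ˣ), ∀ k ∈ T.erase i, ∃ v : HeightOneSpectrum F[X], primeDeg F v = d + 1 ∧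
          genUnit F v = update a i z k := by
        intro z k hk
        rw [update_of_ne (Finset.ne_of_mem_erase hk)]; exact htop k (Finset.mem_of_mem_erase hk)
      have hlow_i : ∀ (z : (RatFunc F)ˣ), z ∈ Subgroup.closure (polyUnitsBelow F d) → ∀ k, k ∉ T.erase i →
          update a i z k ∈ Subgroup.closure (polyUnitsBelow F d) := by
        intro z hz k hk
        by_cases hki : k = i
        · subst hki; rw [update_self]; exact hz
        · rw [update_of_ne hki]; exact hlow k fun h => hk (Finset.mem_erase.2 ⟨hki, h⟩)
      have htop_j : ∀ (z : (RatFunc F)ˣ), ∀ k ∈ T.erase j, ∃ v : HeightOneSpectrum F[X], primeDeg F v = d + 1 ∧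
          genUnit F v = update a j z k := by
        intro z k hk
        rw [update_of_ne (Finset.ne_of_mem_erase hk)]; exact htop k (Finset.mem_of_mem_erase hk)
      have hlow_j : ∀ (z : (RatFunc F)ˣ), z ∈ Subgroup.closure (polyUnitsBelow F d) → ∀ k, k ∉ T.erase j →
          update a j z k ∈ Subgroup.closure (polyUnitsBelow F d) := by
        intro z hz k hk
        by_cases hkj : k = j
        · subst hkj; rw [update_self]; exact hz
        · rw [update_of_ne hkj]; exact hlow k fun h => hk (Finset.mem_erase.2 ⟨hkj, h⟩)
      have htop_ij : ∀ (z w : (RatFunc F)ˣ), ∀ k ∈ (T.erase i).erase j, ∃ v : HeightOneSpectrum F[X],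
          primeDeg F v = d + 1 ∧ genUnit F v = update (update a i z) j w k := by
        intro z w k hk
        rw [update_of_ne (Finset.ne_of_mem_erase hk), update_of_ne (Finset.ne_of_mem_erase (Finset.mem_of_mem_erase hk))]
        exact htop k (Finset.mem_of_mem_erase (Finset.mem_of_mem_erase hk))
      have hlow_ij : ∀ (z w : (RatFunc F)ˣ), z ∈ Subgroup.closure (polyUnitsBelow F d) →
          w ∈ Subgroup.closure (polyUnitsBelow F d) → ∀ k, k ∉ (T.erase i).erase j →
          update (update a i z) j w k ∈ Subgroup.closure (polyUnitsBelow F d) := by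
        intro z w hz hw k hk
        by_cases hkj : k = j
        · subst hkj; rw [update_self]; exact hw
        rw [update_of_ne hkj]
        by_cases hki : k = i
        · subst hki; rw [update_self]; exact hz
        · rw [update_of_ne hki]
          exact hlow k fun h => hk (Finset.mem_erase.2 ⟨hkj, Finset.mem_erase.2 ⟨hki, h⟩⟩)
      by_cases hvv : vi = vj
      · -- equal primes: `{…π…π…} = {…π…−1…}`
        subst hvv
        have heq : a i = a j := by rw [← hai, ← haj]
        rw [symbol_eq_symbol_update_neg_one_of_eq a hij0 heq]
        exact ih _ (T.erase j) hcardj (htop_j _) (hlow_j _ hneg1)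
      · -- the five-term identity
        obtain ⟨hr0, hdr⟩ := monicGen_sub_monicGen hvi hvj hvv
        set R : (RatFunc F)ˣ := polyUnit F _ hr0 with hR
        have hRmem : R ∈ Subgroup.closure (polyUnitsBelow F d) :=
          Subgroup.subset_closure (polyUnit_mem_polyUnitsBelow F hr0 hdr)
        set P : (RatFunc F)ˣ := genUnit F vi with hP
        set Q : (RatFunc F)ˣ := genUnit F vj with hQ
        -- `U z w = {… z@i … w@j …}`
        have hrel : ((-(P * R⁻¹) : (RatFunc F)ˣ) : RatFunc F) + (Q * R⁻¹ : (RatFunc F)ˣ) = 1 := by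
          have hra : algebraMap F[X] (RatFunc F) (monicGen F vj - monicGen F vi) ≠ 0 := R.ne_zero
          rw [Units.val_neg, Units.val_mul, Units.val_mul, Units.val_inv_eq_inv_val, hP, hQ, hR]
          simp only [genUnit, coe_polyUnit]
          rw [← neg_mul, ← add_mul, neg_add_eq_sub, ← map_sub, mul_inv_cancel₀ hra]
        have h0 : symbol (update (update a i (-(P * R⁻¹))) j (Q * R⁻¹)) = 0 :=
          symbol_eq_zero_of_add_eq_one_of_ne _ hij0 (by rw [update_of_ne hij0, update_self, update_self]; exact hrel)
        -- expand slot `j` (outer), then slot `i`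
        have ei : ∀ w : (RatFunc F)ˣ, symbol (update (update a i (-(P * R⁻¹))) j w) =
            symbol (update (update a i (-1)) j w) + symbol (update (update a i P) j w) -
              symbol (update (update a i R) j w) := fun w => by
          rw [update_comm hij0, update_comm hij0, update_comm hij0, update_comm hij0,
            show -(P * R⁻¹) = -1 * P * R⁻¹ by rw [neg_one_mul, neg_mul], symbol_update_mul, symbol_update_mul,
            symbol_update_inv, sub_eq_add_neg]
        rw [symbol_update_mul, symbol_update_inv, ei, ei] at h0
        have haP : update a i P = a := by rw [hai, update_eq_self]
        have haQ : ∀ z, update (update a i z) j Q = update a i z := fun z => by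
          conv_rhs => rw [← update_eq_self j (update a i z)]
          rw [update_of_ne (Ne.symm hij0), haj]
        rw [haQ, haQ, haQ, haP] at h0
        -- solve for `symbol a`
        have hsolve : symbol a = -symbol (update a i (-1)) + symbol (update a i R) +
            (symbol (update (update a i (-1)) j R) + symbol (update a j R) - symbol (update (update a i R) j R)) := by
          rw [← sub_eq_zero, ← h0]; abel
        rw [hsolve]
        refine AddSubgroup.add_mem _ (AddSubgroup.add_mem _ (AddSubgroup.neg_mem _ ?_) ?_)
          (AddSubgroup.sub_mem _ (AddSubgroup.add_mem _ ?_ ?_) ?_)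
        · exact ih _ (T.erase i) hcardi (htop_i _) (hlow_i _ hneg1)
        · exact ih _ (T.erase i) hcardi (htop_i _) (hlow_i _ hRmem)
        · exact ih _ ((T.erase i).erase j) hcardij (htop_ij _ _) (hlow_ij _ _ hneg1 hRmem)
        · exact ih _ (T.erase j) hcardj (htop_j _) (hlow_j _ hRmem)
        · exact ih _ ((T.erase i).erase j) hcardij (htop_ij _ _) (hlow_ij _ _ hRmem hRmem)

/-- **LEMMA 2.5, generation: `L_{d+1} ≤ L_d ⊔ ⟨{π, g} : deg π = d + 1, deg gⱼ ≤ d⟩`** («Thus L_d/L_{d−1} is generated by the images of the homomorphisms h_π»; unique factorisation into atoms first — «But if f₁ is reducible then the product is congruent to zero modulo L_{d−1}»). [cite: Milnor1970, §2 proof of Lemma 2.5 (p0009 L31 – p0010 L12)] -/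
theorem filtrationK_succ_le (d : ℕ) : filtrationK F (n + 1) (d + 1) ≤ filtrationK F (n + 1) d ⊔ topPartK F n d := by
  classical
  rw [filtrationK, AddSubgroup.closure_le]
  rintro z ⟨a, ha, rfl⟩
  have ha' : ∀ j, a j ∈ Subgroup.closure (atomsBelow F (d + 1)) := fun j => by
    rw [← closure_polyUnitsBelow_eq_closure_atomsBelow]; exact Subgroup.subset_closure (ha j)
  refine symbol_mem_of_forall_mem_closure (fun _ => atomsBelow F (d + 1)) _ (fun c hc => ?_) a ha'
  set T : Finset (Fin (n + 1)) := Finset.univ.filter fun j => c j ∉ polyUnitsBelow F d with hT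
  refine symbol_mem_sup_of_card d T.card c T le_rfl (fun j hj => ?_) (fun j hj => ?_)
  · have hj' : c j ∉ polyUnitsBelow F d := (Finset.mem_filter.1 hj).2
    rcases mem_atomsBelow_succ_cases (hc j) with h | h
    · exact absurd h hj'
    · exact h
  · have hj' : c j ∈ polyUnitsBelow F d := by
      by_contra h; exact hj (Finset.mem_filter.2 ⟨Finset.mem_univ j, h⟩)
    exact Subgroup.subset_closure hj'

/-- `L_{d+1} = L_d ⊔ topPartK d`. [cite: Milnor1970, §2 proof of Lemma 2.5 (p0009 L31 – p0010 L12)] -/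
theorem filtrationK_succ_eq (d : ℕ) : filtrationK F (n + 1) (d + 1) = filtrationK F (n + 1) d ⊔ topPartK F n d :=
  le_antisymm (filtrationK_succ_le d) (sup_le (filtrationK_mono (Nat.le_succ d)) (topPartK_le_filtrationK_succ d))

end Lemma25

end MilnorK

end Literature.RingTheory.KTheory

end
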